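import Mathlib
import Summits.Ventures.PercRepro2.Defs
import Summits.Ventures.PercRepro2.Graph
import Summits.Ventures.PercRepro2.Induced
import Summits.Ventures.PercRepro2.VdBKahn
import Summits.Ventures.PercRepro2.ReimerVdBK
import Summits.Ventures.PercRepro2.ReimerVdBKRegions
import Summits.Ventures.PercRepro2.ReimerVdBKZClosed
import Summits.Ventures.PercRepro2.ReimerVdBKZReduction
import Summits.Ventures.PercRepro2.ReimerVdBKZSplit
import Summits.Ventures.PercRepro2.ReimerVdBKZRecursion
import Summits.Ventures.PercRepro2.ReimerVdBKTypeWeight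
import Summits.Ventures.PercRepro2.ReimerVdBKPairType
import Summits.Ventures.PercRepro2.ReimerVdBKCoreDown
import Summits.Ventures.PercRepro2.ReimerVdBKCoreD
import Summits.Ventures.PercRepro2.ReimerVdBKDegTwoGraph

/-!
# The degree-2 expansion, II: loops, flips, and the GENSYM count
(blind cell PercRepro2, mine-c g47; `conjectures/MINE-C.md` §55.6, §56.7)

The colour of a loop does not matter to any cluster event (`conn_update_of_loop`,
`mem_twoWorld_update_of_loop`); flipping one coordinate is an involution of the configurations (`flipE`,
`sum_flipE`), so a function blind to the colour of an edge has half its sum on either colour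
(`two_mul_sum_filter_eq`).  GENSYM (`MINE-C.md` §55.6): the pair weight `2 − [a ∈ K₁][b ∈ K₂] − [b ∈ K₁][a ∈ K₂]`
(`pairW`), the weighted count (`gensymCount`) and the statement `GenSym a b` (left ≤ right).
-/

namespace Summit.Ventures.PercRepro2
namespace ReimerVdBK
open Classical

variable {V : Type*} {E : Type*} [Fintype E] [DecidableEq E] [Fintype V] [DecidableEq V]
variable (ends : E → Sym2 V) (s : V)

/-! ## The colour of a loop does not matter -/

section Loops
variable {ends' : E → Sym2 V}

omit [Fintype E] [Fintype V] [DecidableEq V] in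
/-- The open subgraph ignores the colour of a loop. -/
lemma openGraph_update_of_loop {e : E} (hloop : (ends' e).IsDiag) (ω : Config E) (b : Bool) :
    openGraph ends' (Function.update ω e b) = openGraph ends' ω := by
  ext x y
  simp only [openGraph_adj, OpenAdj]
  constructor
  · rintro ⟨hxy, f, hf, hends⟩
    refine ⟨hxy, f, ?_, hends⟩
    by_cases hfe : f = e
    · exfalso; subst hfe; rw [hends, Sym2.mk_isDiag_iff] at hloop; exact hxy hloop
    · rwa [Function.update_of_ne hfe] at hf
  · rintro ⟨hxy, f, hf, hends⟩
    refine ⟨hxy, f, ?_, hends⟩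
    by_cases hfe : f = e
    · exfalso; subst hfe; rw [hends, Sym2.mk_isDiag_iff] at hloop; exact hxy hloop
    · rwa [Function.update_of_ne hfe]

omit [Fintype E] [Fintype V] [DecidableEq V] in
/-- Connection ignores the colour of a loop. -/
lemma conn_update_of_loop {e : E} (hloop : (ends' e).IsDiag) (ω : Config E) (b : Bool) (x y : V) :
    Conn ends' (Function.update ω e b) x y ↔ Conn ends' ω x y := by
  unfold Conn
  rw [openGraph_update_of_loop hloop]

omit [Fintype E] [Fintype V] [DecidableEq V] in
/-- The complement of an update. -/
lemma compl_update_flip (ω : Config E) (e : E) (b : Bool) :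
    compl (Function.update ω e b) = Function.update (compl ω) e (!b) := by
  funext f
  by_cases hfe : f = e
  · subst hfe; simp [compl]
  · simp [compl, Function.update_of_ne hfe]

omit [Fintype E] [Fintype V] [DecidableEq V] in
/-- The two-world event ignores the colour of a loop. -/
lemma mem_twoWorld_update_of_loop {e : E} (hloop : (ends' e).IsDiag) (ω : Config E) (b : Bool)
    (A X B Y : Finset V) :
    Function.update ω e b ∈ twoWorld ends' s A X B Y ↔ ω ∈ twoWorld ends' s A X B Y := by
  rw [mem_twoWorld_iff, mem_twoWorld_iff]
  simp only [mem_K₁, mem_K₂, compl_update_flip, conn_update_of_loop hloop]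

end Loops

/-! ## Flipping one coordinate -/

section Flip

omit [Fintype E] [Fintype V] [DecidableEq V] in
/-- Flipping the colour of the edge `e`. -/
def flipE (e : E) (ω : Config E) : Config E := Function.update ω e (!ω e)

omit [Fintype E] [Fintype V] [DecidableEq V] in
/-- Flipping twice is the identity. -/
lemma flipE_involutive (e : E) : Function.Involutive (flipE (E := E) e) := by
  intro ω
  funext f
  by_cases hfe : f = e
  · subst hfe; simp [flipE]
  · simp [flipE, Function.update_of_ne hfe]

omit [Fintype E] [Fintype V] [DecidableEq V] in
/-- The flipped edge. -/
lemma flipE_apply_self (e : E) (ω : Config E) : flipE e ω e = !ω e := by simp [flipE]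

omit [Fintype E] [Fintype V] [DecidableEq V] in
/-- Every other edge is unchanged by the flip. -/
lemma flipE_apply_of_ne {e f : E} (h : f ≠ e) (ω : Config E) : flipE e ω f = ω f := by
  simp [flipE, Function.update_of_ne h]

omit [Fintype V] [DecidableEq V] in
/-- Summing over the flipped configurations is summing over all configurations. -/
lemma sum_flipE (e : E) (g : Config E → ℕ) : ∑ ω : Config E, g (flipE e ω) = ∑ ω : Config E, g ω :=
  Equiv.sum_comp (Function.Involutive.toPerm _ (flipE_involutive e)) g

omit [Fintype V] [DecidableEq V] in
/-- For `f` blind to the colour of `e`, the configurations with `e` of either colour carry half the sum. -/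
lemma two_mul_sum_filter_eq (e : E) (f : Config E → ℕ) (hf : ∀ ω, f (flipE e ω) = f ω) (b : Bool) :
    2 * ∑ ω : Config E, (if ω e = b then f ω else 0) = ∑ ω : Config E, f ω := by
  have h1 : ∑ ω : Config E, (if ω e = b then f ω else 0) =
      ∑ ω : Config E, (if ω e = !b then f ω else 0) := by
    conv_rhs => rw [← sum_flipE e]
    refine Finset.sum_congr rfl fun ω _ => ?_
    rw [flipE_apply_self, hf]
    cases b <;> cases h : ω e <;> simp
  have h2 : ∑ ω : Config E, f ω =
      ∑ ω : Config E, ((if ω e = b then f ω else 0) + (if ω e = !b then f ω else 0)) := by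
    refine Finset.sum_congr rfl fun ω _ => ?_
    cases b <;> cases h : ω e <;> simp
  rw [h2, Finset.sum_add_distrib, ← h1, two_mul]

end Flip

/-! ## GENSYM -/

section GenSym
variable (A X B Y : Finset V)

/-- The symmetrised pair weight `2 − [a ∈ K₁][b ∈ K₂] − [b ∈ K₁][a ∈ K₂]` of GENSYM (`MINE-C.md` §55.6),
written without subtraction. -/
noncomputable def pairW (ω : Config E) (a b : V) : ℕ :=
  (if Conn ends ω s a ∧ Conn ends (compl ω) s b then 0 else 1) +
    (if Conn ends ω s b ∧ Conn ends (compl ω) s a then 0 else 1)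

/-- The GENSYM count of the instance: the two-world event weighted by the pair weight of `(a, b)`. -/
noncomputable def gensymCount (a b : V) : ℕ :=
  ∑ ω : Config E, if ω ∈ twoWorld ends s A X B Y then pairW ends s ω a b else 0

/-- **GENSYM`(a, b)` for the instance `(A, X; B, Y)`**: the weighted left count is at most the weighted
right count (meant for Harris pairs; `a = b` is twice (CORE↓) at `a`). -/
def GenSym (a b : V) : Prop :=
  gensymCount ends s A X B Y a b ≤ gensymCount ends s (A ∪ B) ∅ ∅ (X ∪ Y) a b

end GenSym


end ReimerVdBK
end Summit.Ventures.PercRepro2
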